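import Literature.NumberTheory.EllipticCurves.CanonicalPAdicHeightThetaFormalProofs
import Literature.NumberTheory.EllipticCurves.CanonicalPAdicHeightSigmaThetaProofs
import Literature.NumberTheory.EllipticCurves.CanonicalPAdicHeightKProofs
import HarnessLib

/-!
# The canonical `p`-adic height: `exists_isCanonical` rests on the existence of the
# Mazur–Tate sigma function alone (proofs only)

Trunk T-NT-EC (Literature/NumberTheory/EllipticCurves). Bookkeeping file for the named fact
`WeierstrassCurve.exists_isCanonical` (`CanonicalPAdicHeight.lean`; Stein–Wuthrich 2013 §4.1
(4.1), Mazur–Stein–Tate 2006 §1): with the formal theta relation now a theorem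
(`WeierstrassCurve.padicSigma_theta_formal_holds`, `CanonicalPAdicHeightThetaFormalProofs.lean`,
Blakestad–Grant 2023 Prop. 14) and the convergence of the formal group law on `E₁(ℚ_p)`
(`formalGroupLaw_padicEval_holds`), the only input of the sigma-formula route that is not a
theorem of the tree is the EXISTENCE of the Mazur–Tate pair (Mazur–Stein–Tate 2006, Thm. 1.3 =
Mazur–Tate 1991, Thm. 3.1: an odd `σ = t + ⋯ ∈ tℤ_p⟦t⟧` and `c ∈ ℤ_p` with
`x + c = -(d/ω)(σ⁻¹ dσ/ω)` for `W ⊗ ℚ_p`, `W/ℚ` globally minimal, `p ≥ 5` good ordinary). This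
file records the resulting one-hypothesis implications:

* `exists_isCanonical_of_exists_mazurTatePair` — `exists_isCanonical` from the EXISTENCE HALF
  of MST 2006 Thm. 1.3 alone (uniqueness of the pair is not used on the route:
  `exists_isCanonical_of_exists_pair` of `CanonicalPAdicHeightSigmaThetaProofs.lean`);
* `exists_isCanonical_of_mazur_tate_sigma_existsUnique` — in particular from the tree's named
  fact `WeierstrassCurve.mazur_tate_sigma_existsUnique` (`PadicSigma.lean`), which is therefore
  the single named fact behind `exists_isCanonical`; the same for the uniqueness statement
  (`existsUnique_isCanonical_of_mazur_tate_sigma_existsUnique`), for the pointwise theta relation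
  (`padicSigma_theta_of_mazur_tate_sigma_existsUnique`) and for the number-field datum
  (`exists_isCanonicalK_of_mazur_tate_sigma_existsUnique`).

Nothing is asserted; no definition, no named fact.

## Sources

* B. Mazur, W. Stein, J. Tate, *Computation of `p`-adic heights and log convergence*, Doc. Math.
  Extra Vol. Coates (2006), Thm. 1.3, §1, §2.6–2.7.
* B. Mazur, J. Tate, *The `p`-adic sigma function*, Duke Math. J. 62 (1991), Thm. 3.1.
* W. Stein, C. Wuthrich, Math. Comp. 82 (2013), §4.1 eq. (4.1).
* C. Blakestad, D. Grant, J. Number Theory 249 (2023), Prop. 14.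
-/

noncomputable section

open PowerSeries

namespace WeierstrassCurve

/-- **`exists_isCanonical` from the existence half of Mazur–Stein–Tate 2006, Thm. 1.3.** If for
every globally minimal elliptic `W/ℚ` and every prime `p ≥ 5` of good ordinary reduction a
Mazur–Tate pair `(σ, c)` of `W ⊗ ℚ_p` exists, then the canonical `p`-adic height datum exists
(θ₂ = `padicSigma_theta_formal_holds` and θ₃ = `formalGroupLaw_padicEval_holds` are theorems).
[Mazur–Stein–Tate 2006, Thm. 1.3 (existence), §2.7; Stein–Wuthrich 2013, §4.1 eq. (4.1)]
[cite: MazurSteinTate2006, Thm. 1.3] -/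
theorem exists_isCanonical_of_exists_mazurTatePair
    (hex : ∀ (W : WeierstrassCurve ℚ) [W.IsElliptic] [W.IsGloballyMinimal] (p : ℕ) [Fact p.Prime],
      5 ≤ p → W.HasGoodReductionAtPrime p → ¬ (p : ℤ) ∣ W.frobeniusTrace p →
        ∃ σ : ℚ_[p]⟦X⟧, ∃ c : ℚ_[p], (W.baseChange ℚ_[p]).IsMazurTateSigmaPair σ c) :
    exists_isCanonical :=
  exists_isCanonical_of_exists_pair hex padicSigma_theta_formal_holds

/-- The same with uniqueness of the datum. [Mazur–Stein–Tate 2006, §1, Thm. 1.3] [folklore] -/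
theorem existsUnique_isCanonical_of_exists_mazurTatePair
    (hex : ∀ (W : WeierstrassCurve ℚ) [W.IsElliptic] [W.IsGloballyMinimal] (p : ℕ) [Fact p.Prime],
      5 ≤ p → W.HasGoodReductionAtPrime p → ¬ (p : ℤ) ∣ W.frobeniusTrace p →
        ∃ σ : ℚ_[p]⟦X⟧, ∃ c : ℚ_[p], (W.baseChange ℚ_[p]).IsMazurTateSigmaPair σ c)
    (W : WeierstrassCurve ℚ) [W.IsElliptic] [W.IsGloballyMinimal] (p : ℕ) [Fact p.Prime]
    (hp : 5 ≤ p) (hgood : W.HasGoodReductionAtPrime p) (hord : ¬ (p : ℤ) ∣ W.frobeniusTrace p) :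
    ∃! D : PAdicHeightData W p, D.IsCanonical :=
  existsUnique_isCanonical_of_exists_pair hex padicSigma_theta_formal_holds W p hp hgood hord

/-- **The pointwise theta relation `σ(P+Q)σ(P-Q) = (x(Q) - x(P))σ(P)²σ(Q)²` from the existence
of the Mazur–Tate pair.** [Mazur–Tate 1991, Thm. 3.1; Mazur–Stein–Tate 2006, Thm. 1.3]
[folklore] -/
theorem padicSigma_theta_of_exists_mazurTatePair
    (hex : ∀ (W : WeierstrassCurve ℚ) [W.IsElliptic] [W.IsGloballyMinimal] (p : ℕ) [Fact p.Prime],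
      5 ≤ p → W.HasGoodReductionAtPrime p → ¬ (p : ℤ) ∣ W.frobeniusTrace p →
        ∃ σ : ℚ_[p]⟦X⟧, ∃ c : ℚ_[p], (W.baseChange ℚ_[p]).IsMazurTateSigmaPair σ c) :
    padicSigma_theta :=
  padicSigma_theta_of_exists_pair hex padicSigma_theta_formal_holds

/-- **`exists_isCanonical` from the single named fact `mazur_tate_sigma_existsUnique`**
(MST 2006 Thm. 1.3), now the whole trust base of the sigma-formula route.
[Mazur–Stein–Tate 2006, Thm. 1.3, §2.7; Stein–Wuthrich 2013, §4.1 eq. (4.1)]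
[cite: MazurSteinTate2006, Thm. 1.3] -/
theorem exists_isCanonical_of_mazur_tate_sigma_existsUnique (hMT : mazur_tate_sigma_existsUnique) :
    exists_isCanonical :=
  exists_isCanonical_of_MT_theta hMT padicSigma_theta_formal_holds

/-- The same with uniqueness of the datum (admissible multiples exist:
`exists_admissible_nsmul_holds`). [Mazur–Stein–Tate 2006, §1] [folklore] -/
theorem existsUnique_isCanonical_of_mazur_tate_sigma_existsUnique
    (hMT : mazur_tate_sigma_existsUnique) (W : WeierstrassCurve ℚ) [W.IsElliptic]
    [W.IsGloballyMinimal] (p : ℕ) [Fact p.Prime] (hp : 5 ≤ p)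
    (hgood : W.HasGoodReductionAtPrime p) (hord : ¬ (p : ℤ) ∣ W.frobeniusTrace p) :
    ∃! D : PAdicHeightData W p, D.IsCanonical :=
  existsUnique_isCanonical_of_MT_theta' hMT padicSigma_theta_formal_holds W p hp hgood hord

/-- The pointwise theta relation from `mazur_tate_sigma_existsUnique`.
[Mazur–Tate 1991, Thm. 3.1] [folklore] -/
theorem padicSigma_theta_of_mazur_tate_sigma_existsUnique (hMT : mazur_tate_sigma_existsUnique) :
    padicSigma_theta :=
  padicSigma_theta_of_MT_theta hMT padicSigma_theta_formal_holds

/-- **The number-field datum** (`exists_isCanonicalK`, Balakrishnan–Çiperiani–Stein 2015 (4.1))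
from `mazur_tate_sigma_existsUnique`. [Balakrishnan–Çiperiani–Stein 2015, §4.1 eq. (4.1);
Mazur–Stein–Tate 2006, Thm. 1.3] [folklore] -/
theorem exists_isCanonicalK_of_mazur_tate_sigma_existsUnique (hMT : mazur_tate_sigma_existsUnique) :
    exists_isCanonicalK :=
  exists_isCanonicalK_of_MT_theta hMT padicSigma_theta_formal_holds

end WeierstrassCurve
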